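import Summits.BirchSwinnertonDyer.BirchSwinnertonDyer.Theorems.ByReductionTypeAtTwoTowerLayerGreenberg
import Summits.BirchSwinnertonDyer.BirchSwinnertonDyer.Theorems.ByReductionTypeAtTwoGoodOrdTowerKernel
import Literature.NumberTheory.EllipticCurves.Greenberg1999.ControlLocalKernelsLayerGoodProofs
import Literature.NumberTheory.EllipticCurves.Greenberg1999.ControlLocalKernelsLayerBoundProofs
import HarnessLib

/-!
# The β-currency TOWER doors of `…TowerLayerGreenberg` with Greenberg's Lemma 3.3 FED BY NAME
# (route ByReductionTypeAtTwo, crux `OrdKatoHalfAtTwo`, item stmt-BirchSwinnertonDyer-19271; seat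
# bsd-2adic-tower-eng GEN 7, WAKE `plan/WAKE-IDLE-2ADIC-h33-rekey.md`)

HONEST FRAMING (cell `bsd-2adic`, run/shared/lean/pub/bsd-2adic/, HUMAN RULINGS D-0036/D-0054/D-0074/
D-0152): door THEOREMS only; no definition; no new named fact; no `sorry`; closes nothing by itself;
nothing is booked; BSD is NOT proved by any of this. The existing door file is untouched (append-only
tree); this file re-issues its four DISPLAYS with fewer PRINT binders.

Part 4 (`…TowerLayerGreenberg.lean`, seat bsd-2adic-tower-1 GEN 0) displays, at the local error terms of
the TOWER gap certificate, three PRINT binders: `h33g : lemma33_localTowerKerPrimary_eq_bot_of_good.{0}`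
(LNM 1716 Lemma 3.3, good `v ∤ 2`: `𝒦_{v,n}[2^∞] = 0`), `h33 : lemma33_natCard_localTowerKerPrimary_le.{0}`
(Lemma 3.3 eq. (4), any `v ∤ 2`: `#𝒦_{v,n}[2^∞] ≤ #B_v/(B_v)_div`) and
`h34 : lemma34_natCard_localTowerKerPrimary_eq_rat` (Lemma 3.4 for `ℚ`, `v ∣ 2` good ordinary:
`#𝒦_{v,n}[2^∞] = |Ẽ(𝔽₂)_2|²`). The first two are now THEOREMS of the tree:
`lemma33_localTowerKerPrimary_eq_bot_of_good_holds` (`Greenberg1999/ControlLocalKernelsLayerGoodProofs`,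
tower-1 GEN 3; universe-polymorphic) and `lemma33_natCard_localTowerKerPrimary_le_holds`
(`Greenberg1999/ControlLocalKernelsLayerBoundProofs`, bsd-cited r20, p614793; universe `0` = the
doors' universe). This file feeds both BY NAME.

§1 (the WAKE, literal): the four displays with `h33g` AND `h33` fed, `h34` kept —
`towerGapAtTwo_of_layerSelmer_of_lemma34`, `bsdp_two_of_layerSelmer_of_lemma34`,
`mazurMainConjecture_two_of_layerSelmer_of_lemma34`, `katoHalfAt_two_of_layerSelmer_of_lemma34`
(statements = part 4's verbatim minus the two binders; proofs = part 4's doors applied to the two terms).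

§2 (bonus, same road as tower-1 GEN 11's `…GoodOrdTowerKernelDoors` for the cert-currency family): the
four displays with `h34` ALSO discharged — at `v ∣ 2` the kernel theorem
`GoodOrdTower.pTorsion_localTowerKer_at_two_le_four_kernel` (`#𝒦_{v,n}[2] ≤ 4`, good ordinary `2`,
`κ` cyclotomic, every layer) together with `4 ≤ |Ẽ(𝔽₂)_2|²` (`2 ∣ #Ẽ(𝔽₂)` at a good ORDINARY `2`:
`a₂` odd; `four_le_sq_two_pow_padicValNat_reductionPointCount_two`) supplies exactly part 4's
hypothesis (hC) at `2` in the display's own shape `(2^{v₂ #Ẽ(𝔽₂)})²`. Result: the β-currency doors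
`towerGapAtTwo_of_layerSelmer_beta_kernel`, `bsdp_two_…`, `mazurMainConjecture_two_…`,
`katoHalfAt_two_of_layerSelmer_beta_kernel` with NO TOWER PRINT BINDER; what is still PRINT is what was
print OUTSIDE the tower (`h17` Kato 17.4, `h414` Prop. 4.14, `hper₀`; `hEC`/`hmod`/`hGZK` for `BSDp`)
and the certificates are unchanged (`hlow`, `hup`, `hrank`, `β`/`hβ`, the arithmetic, `λ_an`/`μ_an`).
The sharp-exponent family (`…TowerLayerSharp`) is re-issued in the sibling files
`…TowerLayerSharpH33Free` / `…TowerLayerSharpBetaKernel`.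

References: R. Greenberg, LNM 1716 (1999), §3 Lemmas 3.3–3.5 (PDF pp. 86–90), Thm. 4.1, Prop. 4.14;
K. Kato, Astérisque 295 (2004), Thm. 17.4; B. Mazur, Invent. Math. 18 (1972), §7 (anomalous primes).
-/

set_option autoImplicit false
-- the Theorems namespace of this sub repeats the summit name by design (D-0017 nested layout: Summit.<S>.<Sub>)
set_option linter.dupNamespace false

noncomputable section

open scoped Classical MatrixGroups ModularForm

open NumberField IsDedekindDomain CongruenceSubgroup WeierstrassCurve Literature.NumberTheory.EllipticCurves
  Literature.NumberTheory.EllipticCurves.ModularForms Literature.NumberTheory.EllipticCurves.Rank1Residual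
  Literature.NumberTheory.EllipticCurves.Rank1Residual.Typed
  Literature.NumberTheory.EllipticCurves.Greenberg1999
  Summit.BirchSwinnertonDyer.Rank1Residual.X1.MuLambda
  Summit.BirchSwinnertonDyer.Rank1Residual.X1.MuPart
  Summit.BirchSwinnertonDyer.Rank1Residual.X1.ParitySqueeze
  Summit.BirchSwinnertonDyer.BirchSwinnertonDyer.Theorems.Rank1ResidualX1Defs
  Summit.BirchSwinnertonDyer.Rank1Residual.X5 Summit.BirchSwinnertonDyer.Rank1Residual.X5.O1
  Summit.BirchSwinnertonDyer.Rank1Residual.X5.TowerGap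
  Summit.BirchSwinnertonDyer.Rank1Residual

namespace Summit.BirchSwinnertonDyer.BirchSwinnertonDyer.Theorems.KatoHalfPinch

section Curve

variable (W : WeierstrassCurve ℚ) [W.IsElliptic] [W.IsGloballyMinimal]

/-! ### §1 The WAKE: `h33g` and `h33` fed by name, `h34` kept -/

/-- **The GAP certificate (crude exponent) from Lemma 3.4@2 + certificates**: part 4's
`towerGapAtTwo_of_layerSelmer_of_greenberg` with BOTH parts of Greenberg's Lemma 3.3 supplied by the
tree's theorems `lemma33_localTowerKerPrimary_eq_bot_of_good_holds` /
`lemma33_natCard_localTowerKerPrimary_le_holds`; the one remaining tower PRINT binder is `h34`.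
[cite: GreenbergLNM1716, §3 Lemmas 3.3, 3.4, 3.5 (PDF pp. 86–90)] [cite: Washington1997, §13.2] -/
theorem towerGapAtTwo_of_layerSelmer_of_lemma34
    (h34 : lemma34_natCard_localTowerKerPrimary_eq_rat)
    (hgo : GoodOrd W 2) (htors : ¬ 2 ∣ W.torsionOrder) {j j' a d : ℕ} (hjj' : j ≤ j')
    (S : Finset (HeightOneSpectrum (𝓞 ℚ)))
    (hS : ∀ v ∉ S, ((2 : ℕ) : 𝓞 ℚ) ∉ v.asIdeal ∧ W.HasGoodReductionAt v)
    (β : HeightOneSpectrum (𝓞 ℚ) → ℕ)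
    (hβ : ∀ κ : ZpExtension ℚ 2, κ.IsCyclotomic → ∀ v ∈ S, ((2 : ℕ) : 𝓞 ℚ) ∉ v.asIdeal →
      Nat.card (↥(W.localTopPrimary κ (v.adicCompletion ℚ)) ⧸
        W.localTopPrimaryDiv κ (v.adicCompletion ℚ)) ≤ β v)
    (hlow : ∀ κ : ZpExtension ℚ 2, κ.IsCyclotomic →
      2 ^ a ≤ Nat.card {z : W.selmerLayer κ j // 2 • z = 0})
    (hup : ∀ κ : ZpExtension ℚ 2, κ.IsCyclotomic →
      Nat.card {z : W.selmerLayer κ j' // 2 • z = 0} ≤ 2 ^ d)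
    (harith : 2 ^ d * ∏ v ∈ S,
        (if ((2 : ℕ) : 𝓞 ℚ) ∈ v.asIdeal then (2 ^ padicValNat 2 (W.reductionPointCount 2)) ^ 2
          else β v) ^ (if ((2 : ℕ) : 𝓞 ℚ) ∈ v.asIdeal then 1 else 2 ^ j') <
      2 ^ (2 ^ j' - 2 ^ j + a)) : TowerGapAtTwo W :=
  towerGapAtTwo_of_layerSelmer_of_greenberg W lemma33_localTowerKerPrimary_eq_bot_of_good_holds.{0}
    lemma33_natCard_localTowerKerPrimary_le_holds h34 hgo htors hjj' S hS β hβ hlow hup harith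

/-- **Door (TOWER, crude exponent; Lemma 3.3 fed by name) for `BSD(E,2)` at analytic rank `0`** on a
good-ordinary-at-`2` curve with odd torsion order: PRINT {modularity, GZK, Kato 17.4 (1)(2)@2,
Greenberg Thm. 4.1@2, Prop. 4.14@2, Lemma 3.4@2 (`ℚ`)} + CERTIFICATES {`hper₀`, `μ_an = 0`, `λ_an = n`,
`2^n ≤ #Sel_{2^∞}(E/ℚ_{j₀})[2]`, `2^a ≤ #Sel_{2^∞}(E/ℚ_j)[2]`, `#Sel_{2^∞}(E/ℚ_{j'})[2] ≤ 2^d`, `β_v`,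
arithmetic} ⇒ `BSDp W 2` (part 4's `bsdp_two_of_layerSelmer_of_greenberg`, `h33g`/`h33` fed).
[cite: GreenbergLNM1716, Thm. 4.1, Prop. 4.14, §3 Lemmas 3.3–3.5] [cite: Kato2004Asterisque, Thm. 17.4 (1)(2) (p. 273)]
[cite: Miller2011LMS, Def. 1.1] -/
theorem bsdp_two_of_layerSelmer_of_lemma34 (hmod : nonempty_modularParametrizationData)
    (hGZK : rank_eq_analyticRank_of_analyticRank_le_one)
    (h17 : ∀ [NeZero (W.conductorNorm ℤ)] (f : CuspForm (Gamma0 (W.conductorNorm ℤ)) 2),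
      kato_divisibility_allPrimes W 2 (f := f))
    (hEC : TwoAdicEulerCharRankZero W 0) (h414 : prop414_noFiniteSubmodule_of_not_dvd_torsionOrder)
    (h34 : lemma34_natCard_localTowerKerPrimary_eq_rat)
    (hper₀ : ∀ [NeZero (W.conductorNorm ℤ)] (f : CuspForm (Gamma0 (W.conductorNorm ℤ)) 2),
      IsNewformOf W f → ∀ ϖ : ℚ, (ϖ : ℝ) * W.realPeriodRat = plusPeriod f → 0 ≤ padicValRat 2 ϖ)
    (hgo : GoodOrd W 2) (hr : W.analyticRank = 0) (htors : ¬ 2 ∣ W.torsionOrder) {n j₀ j j' a d : ℕ}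
    (hrank : ∀ κ : ZpExtension ℚ 2, κ.IsCyclotomic →
      2 ^ n ≤ Nat.card {z : W.selmerLayer κ j₀ // 2 • z = 0})
    (hjj' : j ≤ j') (S : Finset (HeightOneSpectrum (𝓞 ℚ)))
    (hS : ∀ v ∉ S, ((2 : ℕ) : 𝓞 ℚ) ∉ v.asIdeal ∧ W.HasGoodReductionAt v)
    (β : HeightOneSpectrum (𝓞 ℚ) → ℕ)
    (hβ : ∀ κ : ZpExtension ℚ 2, κ.IsCyclotomic → ∀ v ∈ S, ((2 : ℕ) : 𝓞 ℚ) ∉ v.asIdeal →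
      Nat.card (↥(W.localTopPrimary κ (v.adicCompletion ℚ)) ⧸
        W.localTopPrimaryDiv κ (v.adicCompletion ℚ)) ≤ β v)
    (hlow : ∀ κ : ZpExtension ℚ 2, κ.IsCyclotomic →
      2 ^ a ≤ Nat.card {z : W.selmerLayer κ j // 2 • z = 0})
    (hup : ∀ κ : ZpExtension ℚ 2, κ.IsCyclotomic →
      Nat.card {z : W.selmerLayer κ j' // 2 • z = 0} ≤ 2 ^ d)
    (harith : 2 ^ d * ∏ v ∈ S,
        (if ((2 : ℕ) : 𝓞 ℚ) ∈ v.asIdeal then (2 ^ padicValNat 2 (W.reductionPointCount 2)) ^ 2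
          else β v) ^ (if ((2 : ℕ) : 𝓞 ℚ) ∈ v.asIdeal then 1 else 2 ^ j') <
      2 ^ (2 ^ j' - 2 ^ j + a))
    (hlan : AnalyticLambdaEq W 2 n) (hμan : AnalyticMuLE W 2 0) : BSDp W 2 :=
  bsdp_two_of_layerSelmer_of_greenberg W hmod hGZK h17 hEC h414
    lemma33_localTowerKerPrimary_eq_bot_of_good_holds.{0} lemma33_natCard_localTowerKerPrimary_le_holds
    h34 hper₀ hgo hr htors hrank hjj' S hS β hβ hlow hup harith hlan hμan

/-- **Door (TOWER, crude exponent; Lemma 3.3 fed by name): `MazurMainConjecture W 2`** — any analytic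
rank, odd torsion order (part 4's `mazurMainConjecture_two_of_layerSelmer_of_greenberg`, `h33g`/`h33`
fed). [cite: Kato2004Asterisque, Thm. 17.4 (1)(2) (p. 273)] [cite: GreenbergLNM1716, Prop. 4.14, §3 Lemmas 3.3–3.5] -/
theorem mazurMainConjecture_two_of_layerSelmer_of_lemma34
    (h17 : ∀ [NeZero (W.conductorNorm ℤ)] (f : CuspForm (Gamma0 (W.conductorNorm ℤ)) 2),
      kato_divisibility_allPrimes W 2 (f := f))
    (h414 : prop414_noFiniteSubmodule_of_not_dvd_torsionOrder)
    (h34 : lemma34_natCard_localTowerKerPrimary_eq_rat)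
    (hper₀ : ∀ [NeZero (W.conductorNorm ℤ)] (f : CuspForm (Gamma0 (W.conductorNorm ℤ)) 2),
      IsNewformOf W f → ∀ ϖ : ℚ, (ϖ : ℝ) * W.realPeriodRat = plusPeriod f → 0 ≤ padicValRat 2 ϖ)
    (hgo : GoodOrd W 2) (htors : ¬ 2 ∣ W.torsionOrder) {n j₀ j j' a d : ℕ}
    (hrank : ∀ κ : ZpExtension ℚ 2, κ.IsCyclotomic →
      2 ^ n ≤ Nat.card {z : W.selmerLayer κ j₀ // 2 • z = 0})
    (hjj' : j ≤ j') (S : Finset (HeightOneSpectrum (𝓞 ℚ)))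
    (hS : ∀ v ∉ S, ((2 : ℕ) : 𝓞 ℚ) ∉ v.asIdeal ∧ W.HasGoodReductionAt v)
    (β : HeightOneSpectrum (𝓞 ℚ) → ℕ)
    (hβ : ∀ κ : ZpExtension ℚ 2, κ.IsCyclotomic → ∀ v ∈ S, ((2 : ℕ) : 𝓞 ℚ) ∉ v.asIdeal →
      Nat.card (↥(W.localTopPrimary κ (v.adicCompletion ℚ)) ⧸
        W.localTopPrimaryDiv κ (v.adicCompletion ℚ)) ≤ β v)
    (hlow : ∀ κ : ZpExtension ℚ 2, κ.IsCyclotomic →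
      2 ^ a ≤ Nat.card {z : W.selmerLayer κ j // 2 • z = 0})
    (hup : ∀ κ : ZpExtension ℚ 2, κ.IsCyclotomic →
      Nat.card {z : W.selmerLayer κ j' // 2 • z = 0} ≤ 2 ^ d)
    (harith : 2 ^ d * ∏ v ∈ S,
        (if ((2 : ℕ) : 𝓞 ℚ) ∈ v.asIdeal then (2 ^ padicValNat 2 (W.reductionPointCount 2)) ^ 2
          else β v) ^ (if ((2 : ℕ) : 𝓞 ℚ) ∈ v.asIdeal then 1 else 2 ^ j') <
      2 ^ (2 ^ j' - 2 ^ j + a))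
    (hlan : AnalyticLambdaEq W 2 n) (hμan : AnalyticMuLE W 2 0) : MazurMainConjecture W 2 :=
  mazurMainConjecture_two_of_layerSelmer_of_greenberg W h17 h414
    lemma33_localTowerKerPrimary_eq_bot_of_good_holds.{0} lemma33_natCard_localTowerKerPrimary_le_holds
    h34 hper₀ hgo htors hrank hjj' S hS β hβ hlow hup harith hlan hμan

/-- **The Kato–Néron half (the item `OrdKatoHalfAtTwo` AT `W`), crude exponent, Lemma 3.3 fed by
name** (part 4's `katoHalfAt_two_of_layerSelmer_of_greenberg`, `h33g`/`h33` fed).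
[cite: Kato2004Asterisque, Thm. 17.4 (1)(2) (p. 273)] [cite: GreenbergLNM1716, Prop. 4.14, §3 Lemmas 3.3–3.5] -/
theorem katoHalfAt_two_of_layerSelmer_of_lemma34
    (h17 : ∀ [NeZero (W.conductorNorm ℤ)] (f : CuspForm (Gamma0 (W.conductorNorm ℤ)) 2),
      kato_divisibility_allPrimes W 2 (f := f))
    (h414 : prop414_noFiniteSubmodule_of_not_dvd_torsionOrder)
    (h34 : lemma34_natCard_localTowerKerPrimary_eq_rat)
    (hper₀ : ∀ [NeZero (W.conductorNorm ℤ)] (f : CuspForm (Gamma0 (W.conductorNorm ℤ)) 2),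
      IsNewformOf W f → ∀ ϖ : ℚ, (ϖ : ℝ) * W.realPeriodRat = plusPeriod f → 0 ≤ padicValRat 2 ϖ)
    (hgo : GoodOrd W 2) (htors : ¬ 2 ∣ W.torsionOrder) {n j₀ j j' a d : ℕ}
    (hrank : ∀ κ : ZpExtension ℚ 2, κ.IsCyclotomic →
      2 ^ n ≤ Nat.card {z : W.selmerLayer κ j₀ // 2 • z = 0})
    (hjj' : j ≤ j') (S : Finset (HeightOneSpectrum (𝓞 ℚ)))
    (hS : ∀ v ∉ S, ((2 : ℕ) : 𝓞 ℚ) ∉ v.asIdeal ∧ W.HasGoodReductionAt v)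
    (β : HeightOneSpectrum (𝓞 ℚ) → ℕ)
    (hβ : ∀ κ : ZpExtension ℚ 2, κ.IsCyclotomic → ∀ v ∈ S, ((2 : ℕ) : 𝓞 ℚ) ∉ v.asIdeal →
      Nat.card (↥(W.localTopPrimary κ (v.adicCompletion ℚ)) ⧸
        W.localTopPrimaryDiv κ (v.adicCompletion ℚ)) ≤ β v)
    (hlow : ∀ κ : ZpExtension ℚ 2, κ.IsCyclotomic →
      2 ^ a ≤ Nat.card {z : W.selmerLayer κ j // 2 • z = 0})
    (hup : ∀ κ : ZpExtension ℚ 2, κ.IsCyclotomic →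
      Nat.card {z : W.selmerLayer κ j' // 2 • z = 0} ≤ 2 ^ d)
    (harith : 2 ^ d * ∏ v ∈ S,
        (if ((2 : ℕ) : 𝓞 ℚ) ∈ v.asIdeal then (2 ^ padicValNat 2 (W.reductionPointCount 2)) ^ 2
          else β v) ^ (if ((2 : ℕ) : 𝓞 ℚ) ∈ v.asIdeal then 1 else 2 ^ j') <
      2 ^ (2 ^ j' - 2 ^ j + a))
    (hlan : AnalyticLambdaEq W 2 n) (hμan : AnalyticMuLE W 2 0) :
    MainConjectureLowerDivisibilityAtTwoOrd W :=
  katoHalfAt_two_of_layerSelmer_of_greenberg W h17 h414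
    lemma33_localTowerKerPrimary_eq_bot_of_good_holds.{0} lemma33_natCard_localTowerKerPrimary_le_holds
    h34 hper₀ hgo htors hrank hjj' S hS β hβ hlow hup harith hlan hμan

/-! ### §2 Bonus: `h34` also discharged — the β-currency doors with NO tower print binder -/

omit [W.IsElliptic] in
/-- **`4 ≤ |Ẽ(𝔽₂)_2|²` at a good ORDINARY `2`**: `a₂ = 3 − #Ẽ(𝔽₂)` is odd, so `2 ∣ #Ẽ(𝔽₂)` (the prime
`2` is anomalous at every good ordinary curve; cf. the sibling
`TwoAdicTwistConverse.two_dvd_reductionPointCount_two`), hence `2 ≤ 2^{v₂ #Ẽ(𝔽₂)}`. This is what makes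
GEN 11's kernel bound `#𝒦_{v,n}[2] ≤ 4` at `v ∣ 2` fit the display's constant `(2^{v₂ #Ẽ(𝔽₂)})²`.
[cite: Mazur1972, §7] -/
theorem four_le_sq_two_pow_padicValNat_reductionPointCount_two (hgo : GoodOrd W 2) :
    4 ≤ (2 ^ padicValNat 2 (W.reductionPointCount 2)) ^ 2 := by
  haveI : Fact (Nat.Prime 2) := ⟨Nat.prime_two⟩
  have h2N : 2 ∣ W.reductionPointCount 2 := by
    have h := hgo.2
    simp only [WeierstrassCurve.frobeniusTrace] at h
    omega
  have h1 : 1 ≤ padicValNat 2 (W.reductionPointCount 2) :=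
    one_le_padicValNat_of_dvd (W.reductionPointCount_pos 2).ne' h2N
  calc (4 : ℕ) = (2 ^ 1) ^ 2 := by norm_num
    _ ≤ (2 ^ padicValNat 2 (W.reductionPointCount 2)) ^ 2 :=
      Nat.pow_le_pow_left (Nat.pow_le_pow_right (by norm_num) h1) 2

/-- **The GAP certificate (crude exponent) with NO tower print binder, β-currency**: the display
`towerGapAtTwo_of_layerSelmer_of_greenberg` (part 4) minus `h33g`, `h33`, `h34` — good `v ∤ 2` off `S`
by `lemma33_localTowerKerPrimary_eq_bot_of_good_holds`, odd `v ∈ S` by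
`lemma33_natCard_localTowerKerPrimary_le_holds` + the certificate `β_v`, and `v ∣ 2` by the kernel theorem
`GoodOrdTower.pTorsion_localTowerKer_at_two_le_four_kernel` (`#𝒦_{v,j'}[2] ≤ 4 ≤ |Ẽ(𝔽₂)_2|²`); covers
`N_2 = 1`, `N_v = 2^{j'}` (part 3a). CERTIFICATES unchanged.
[cite: GreenbergLNM1716, §3 Lemmas 3.3, 3.4, 3.5 (PDF pp. 86–90)] [cite: Washington1997, §13.2] -/
theorem towerGapAtTwo_of_layerSelmer_beta_kernel
    (hgo : GoodOrd W 2) (htors : ¬ 2 ∣ W.torsionOrder) {j j' a d : ℕ} (hjj' : j ≤ j')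
    (S : Finset (HeightOneSpectrum (𝓞 ℚ)))
    (hS : ∀ v ∉ S, ((2 : ℕ) : 𝓞 ℚ) ∉ v.asIdeal ∧ W.HasGoodReductionAt v)
    (β : HeightOneSpectrum (𝓞 ℚ) → ℕ)
    (hβ : ∀ κ : ZpExtension ℚ 2, κ.IsCyclotomic → ∀ v ∈ S, ((2 : ℕ) : 𝓞 ℚ) ∉ v.asIdeal →
      Nat.card (↥(W.localTopPrimary κ (v.adicCompletion ℚ)) ⧸
        W.localTopPrimaryDiv κ (v.adicCompletion ℚ)) ≤ β v)
    (hlow : ∀ κ : ZpExtension ℚ 2, κ.IsCyclotomic →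
      2 ^ a ≤ Nat.card {z : W.selmerLayer κ j // 2 • z = 0})
    (hup : ∀ κ : ZpExtension ℚ 2, κ.IsCyclotomic →
      Nat.card {z : W.selmerLayer κ j' // 2 • z = 0} ≤ 2 ^ d)
    (harith : 2 ^ d * ∏ v ∈ S,
        (if ((2 : ℕ) : 𝓞 ℚ) ∈ v.asIdeal then (2 ^ padicValNat 2 (W.reductionPointCount 2)) ^ 2
          else β v) ^ (if ((2 : ℕ) : 𝓞 ℚ) ∈ v.asIdeal then 1 else 2 ^ j') <
      2 ^ (2 ^ j' - 2 ^ j + a)) : TowerGapAtTwo W := by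
  refine towerGapAtTwo_of_localKernelBounds W htors hjj' S
    (fun v ↦ if ((2 : ℕ) : 𝓞 ℚ) ∈ v.asIdeal then (2 ^ padicValNat 2 (W.reductionPointCount 2)) ^ 2
      else β v)
    (fun v ↦ if ((2 : ℕ) : 𝓞 ℚ) ∈ v.asIdeal then 1 else 2 ^ j') hlow hup
    (fun κ hκ v hv ↦ lemma33_localTowerKerPrimary_eq_bot_of_good_holds ℚ W 2 κ hκ v (hS v hv).1
      (hS v hv).2 j') (fun κ hκ v hv ↦ ?_) (fun κ hκ v hv ↦ ?_) harith
  · by_cases h2 : ((2 : ℕ) : 𝓞 ℚ) ∈ v.asIdeal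
    · rw [if_pos h2]
      obtain ⟨hfin, hle⟩ := GoodOrdTower.pTorsion_localTowerKer_at_two_le_four_kernel W hgo κ hκ v h2 j'
      exact ⟨hfin, hle.trans (four_le_sq_two_pow_padicValNat_reductionPointCount_two W hgo)⟩
    · rw [if_neg h2]
      obtain ⟨hfin, hle⟩ :=
        pTorsion_le_of_lemma33 lemma33_natCard_localTowerKerPrimary_le_holds W 2 κ hκ v h2 j'
      exact ⟨hfin, hle.trans (hβ κ hκ v hv h2)⟩
  · by_cases h2 : ((2 : ℕ) : 𝓞 ℚ) ∈ v.asIdeal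
    · refine ⟨{1}, by rw [if_pos h2, Finset.card_singleton], ?_⟩
      exact TowerLayer.cover_singleton_at_p κ hκ v h2 j'
    · obtain ⟨R, hR, hcov⟩ := TowerLayer.exists_cover_of_layerSubgroup κ (v.adicCompletion ℚ) j'
      exact ⟨R, by rw [if_neg h2, hR], hcov⟩

/-- **Door (TOWER, crude exponent, β-currency; NO tower print binder) for `BSD(E,2)` at analytic rank
`0`** on a good-ordinary-at-`2` curve with odd torsion order: PRINT {modularity, GZK, Kato 17.4
(1)(2)@2, Greenberg Thm. 4.1@2, Prop. 4.14@2} + CERTIFICATES {`hper₀`, `μ_an = 0`, `λ_an = n`,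
`2^n ≤ #Sel_{2^∞}(E/ℚ_{j₀})[2]`, `2^a ≤ #Sel_{2^∞}(E/ℚ_j)[2]`, `#Sel_{2^∞}(E/ℚ_{j'})[2] ≤ 2^d`, `β_v`,
arithmetic} ⇒ `BSDp W 2` — the display `bsdp_two_of_layerSelmer_of_greenberg` minus `h33g`/`h33`/`h34`.
[cite: GreenbergLNM1716, Thm. 4.1, Prop. 4.14, §3 Lemmas 3.3–3.5] [cite: Kato2004Asterisque, Thm. 17.4 (1)(2) (p. 273)]
[cite: Miller2011LMS, Def. 1.1] -/
theorem bsdp_two_of_layerSelmer_beta_kernel (hmod : nonempty_modularParametrizationData)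
    (hGZK : rank_eq_analyticRank_of_analyticRank_le_one)
    (h17 : ∀ [NeZero (W.conductorNorm ℤ)] (f : CuspForm (Gamma0 (W.conductorNorm ℤ)) 2),
      kato_divisibility_allPrimes W 2 (f := f))
    (hEC : TwoAdicEulerCharRankZero W 0) (h414 : prop414_noFiniteSubmodule_of_not_dvd_torsionOrder)
    (hper₀ : ∀ [NeZero (W.conductorNorm ℤ)] (f : CuspForm (Gamma0 (W.conductorNorm ℤ)) 2),
      IsNewformOf W f → ∀ ϖ : ℚ, (ϖ : ℝ) * W.realPeriodRat = plusPeriod f → 0 ≤ padicValRat 2 ϖ)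
    (hgo : GoodOrd W 2) (hr : W.analyticRank = 0) (htors : ¬ 2 ∣ W.torsionOrder) {n j₀ j j' a d : ℕ}
    (hrank : ∀ κ : ZpExtension ℚ 2, κ.IsCyclotomic →
      2 ^ n ≤ Nat.card {z : W.selmerLayer κ j₀ // 2 • z = 0})
    (hjj' : j ≤ j') (S : Finset (HeightOneSpectrum (𝓞 ℚ)))
    (hS : ∀ v ∉ S, ((2 : ℕ) : 𝓞 ℚ) ∉ v.asIdeal ∧ W.HasGoodReductionAt v)
    (β : HeightOneSpectrum (𝓞 ℚ) → ℕ)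
    (hβ : ∀ κ : ZpExtension ℚ 2, κ.IsCyclotomic → ∀ v ∈ S, ((2 : ℕ) : 𝓞 ℚ) ∉ v.asIdeal →
      Nat.card (↥(W.localTopPrimary κ (v.adicCompletion ℚ)) ⧸
        W.localTopPrimaryDiv κ (v.adicCompletion ℚ)) ≤ β v)
    (hlow : ∀ κ : ZpExtension ℚ 2, κ.IsCyclotomic →
      2 ^ a ≤ Nat.card {z : W.selmerLayer κ j // 2 • z = 0})
    (hup : ∀ κ : ZpExtension ℚ 2, κ.IsCyclotomic →
      Nat.card {z : W.selmerLayer κ j' // 2 • z = 0} ≤ 2 ^ d)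
    (harith : 2 ^ d * ∏ v ∈ S,
        (if ((2 : ℕ) : 𝓞 ℚ) ∈ v.asIdeal then (2 ^ padicValNat 2 (W.reductionPointCount 2)) ^ 2
          else β v) ^ (if ((2 : ℕ) : 𝓞 ℚ) ∈ v.asIdeal then 1 else 2 ^ j') <
      2 ^ (2 ^ j' - 2 ^ j + a))
    (hlan : AnalyticLambdaEq W 2 n) (hμan : AnalyticMuLE W 2 0) : BSDp W 2 :=
  bsdp_two_of_towerGap_of_layerSelmer W hmod hGZK h17 hEC h414 hper₀ hgo hr htors
    (towerGapAtTwo_of_layerSelmer_beta_kernel W hgo htors hjj' S hS β hβ hlow hup harith)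
    hrank hlan hμan

/-- **Door (TOWER, crude exponent, β-currency; NO tower print binder): `MazurMainConjecture W 2`** —
any analytic rank, odd torsion order (the display `mazurMainConjecture_two_of_layerSelmer_of_greenberg`
minus `h33g`/`h33`/`h34`). [cite: Kato2004Asterisque, Thm. 17.4 (1)(2) (p. 273)]
[cite: GreenbergLNM1716, Prop. 4.14, §3 Lemmas 3.3–3.5] -/
theorem mazurMainConjecture_two_of_layerSelmer_beta_kernel
    (h17 : ∀ [NeZero (W.conductorNorm ℤ)] (f : CuspForm (Gamma0 (W.conductorNorm ℤ)) 2),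
      kato_divisibility_allPrimes W 2 (f := f))
    (h414 : prop414_noFiniteSubmodule_of_not_dvd_torsionOrder)
    (hper₀ : ∀ [NeZero (W.conductorNorm ℤ)] (f : CuspForm (Gamma0 (W.conductorNorm ℤ)) 2),
      IsNewformOf W f → ∀ ϖ : ℚ, (ϖ : ℝ) * W.realPeriodRat = plusPeriod f → 0 ≤ padicValRat 2 ϖ)
    (hgo : GoodOrd W 2) (htors : ¬ 2 ∣ W.torsionOrder) {n j₀ j j' a d : ℕ}
    (hrank : ∀ κ : ZpExtension ℚ 2, κ.IsCyclotomic →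
      2 ^ n ≤ Nat.card {z : W.selmerLayer κ j₀ // 2 • z = 0})
    (hjj' : j ≤ j') (S : Finset (HeightOneSpectrum (𝓞 ℚ)))
    (hS : ∀ v ∉ S, ((2 : ℕ) : 𝓞 ℚ) ∉ v.asIdeal ∧ W.HasGoodReductionAt v)
    (β : HeightOneSpectrum (𝓞 ℚ) → ℕ)
    (hβ : ∀ κ : ZpExtension ℚ 2, κ.IsCyclotomic → ∀ v ∈ S, ((2 : ℕ) : 𝓞 ℚ) ∉ v.asIdeal →
      Nat.card (↥(W.localTopPrimary κ (v.adicCompletion ℚ)) ⧸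
        W.localTopPrimaryDiv κ (v.adicCompletion ℚ)) ≤ β v)
    (hlow : ∀ κ : ZpExtension ℚ 2, κ.IsCyclotomic →
      2 ^ a ≤ Nat.card {z : W.selmerLayer κ j // 2 • z = 0})
    (hup : ∀ κ : ZpExtension ℚ 2, κ.IsCyclotomic →
      Nat.card {z : W.selmerLayer κ j' // 2 • z = 0} ≤ 2 ^ d)
    (harith : 2 ^ d * ∏ v ∈ S,
        (if ((2 : ℕ) : 𝓞 ℚ) ∈ v.asIdeal then (2 ^ padicValNat 2 (W.reductionPointCount 2)) ^ 2
          else β v) ^ (if ((2 : ℕ) : 𝓞 ℚ) ∈ v.asIdeal then 1 else 2 ^ j') <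
      2 ^ (2 ^ j' - 2 ^ j + a))
    (hlan : AnalyticLambdaEq W 2 n) (hμan : AnalyticMuLE W 2 0) : MazurMainConjecture W 2 :=
  mazurMainConjecture_two_of_towerGap_of_layerSelmer W h17 h414 hper₀ hgo htors
    (towerGapAtTwo_of_layerSelmer_beta_kernel W hgo htors hjj' S hS β hβ hlow hup harith)
    hrank hlan hμan

/-- **The Kato–Néron half (the item `OrdKatoHalfAtTwo` AT `W`), crude exponent, β-currency, NO tower
print binder** (the display `katoHalfAt_two_of_layerSelmer_of_greenberg` minus `h33g`/`h33`/`h34`).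
[cite: Kato2004Asterisque, Thm. 17.4 (1)(2) (p. 273)] [cite: GreenbergLNM1716, Prop. 4.14, §3 Lemmas 3.3–3.5] -/
theorem katoHalfAt_two_of_layerSelmer_beta_kernel
    (h17 : ∀ [NeZero (W.conductorNorm ℤ)] (f : CuspForm (Gamma0 (W.conductorNorm ℤ)) 2),
      kato_divisibility_allPrimes W 2 (f := f))
    (h414 : prop414_noFiniteSubmodule_of_not_dvd_torsionOrder)
    (hper₀ : ∀ [NeZero (W.conductorNorm ℤ)] (f : CuspForm (Gamma0 (W.conductorNorm ℤ)) 2),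
      IsNewformOf W f → ∀ ϖ : ℚ, (ϖ : ℝ) * W.realPeriodRat = plusPeriod f → 0 ≤ padicValRat 2 ϖ)
    (hgo : GoodOrd W 2) (htors : ¬ 2 ∣ W.torsionOrder) {n j₀ j j' a d : ℕ}
    (hrank : ∀ κ : ZpExtension ℚ 2, κ.IsCyclotomic →
      2 ^ n ≤ Nat.card {z : W.selmerLayer κ j₀ // 2 • z = 0})
    (hjj' : j ≤ j') (S : Finset (HeightOneSpectrum (𝓞 ℚ)))
    (hS : ∀ v ∉ S, ((2 : ℕ) : 𝓞 ℚ) ∉ v.asIdeal ∧ W.HasGoodReductionAt v)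
    (β : HeightOneSpectrum (𝓞 ℚ) → ℕ)
    (hβ : ∀ κ : ZpExtension ℚ 2, κ.IsCyclotomic → ∀ v ∈ S, ((2 : ℕ) : 𝓞 ℚ) ∉ v.asIdeal →
      Nat.card (↥(W.localTopPrimary κ (v.adicCompletion ℚ)) ⧸
        W.localTopPrimaryDiv κ (v.adicCompletion ℚ)) ≤ β v)
    (hlow : ∀ κ : ZpExtension ℚ 2, κ.IsCyclotomic →
      2 ^ a ≤ Nat.card {z : W.selmerLayer κ j // 2 • z = 0})
    (hup : ∀ κ : ZpExtension ℚ 2, κ.IsCyclotomic →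
      Nat.card {z : W.selmerLayer κ j' // 2 • z = 0} ≤ 2 ^ d)
    (harith : 2 ^ d * ∏ v ∈ S,
        (if ((2 : ℕ) : 𝓞 ℚ) ∈ v.asIdeal then (2 ^ padicValNat 2 (W.reductionPointCount 2)) ^ 2
          else β v) ^ (if ((2 : ℕ) : 𝓞 ℚ) ∈ v.asIdeal then 1 else 2 ^ j') <
      2 ^ (2 ^ j' - 2 ^ j + a))
    (hlan : AnalyticLambdaEq W 2 n) (hμan : AnalyticMuLE W 2 0) :
    MainConjectureLowerDivisibilityAtTwoOrd W :=
  katoHalfAt_two_of_towerGap_of_layerSelmer W h17 h414 hper₀ hgo htors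
    (towerGapAtTwo_of_layerSelmer_beta_kernel W hgo htors hjj' S hS β hβ hlow hup harith)
    hrank hlan hμan

end Curve

end Summit.BirchSwinnertonDyer.BirchSwinnertonDyer.Theorems.KatoHalfPinch

end
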